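import Literature.Computability.QuantumComplexity.RevGadgets
import HarnessLib

/-!
# Reversible gadgets for multiplexing over a data-dependent length: swaps, one-hot length flags, flag-controlled copies

Trunk `CryptoQuantFine`, toolkit continuing `RevGadgets.lean` (`ClOp` programs of
`NOT`/`CNOT`/Toffoli over an abstract wire type, `clEval`, `clToggle`) and `RevUncompute.lean`
(the garbage-free block computing an `FP` function, whose result wires hold the one-hot codes
of the cells of the output word). Towards the named fact
`Literature.Computability.Cryptography.isQSolvable_classicalWrap` (classical pre- and
post-processing inside bounded-error quantum search, Bernstein–Vazirani 1997, §8): there the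
pre-processor output `h x` has a *data-dependent* length `ℓ* ≤ L(n)`, and the circuit for input
length `n` must contain one copy of the given family's circuit for every length `ℓ ≤ L(n)`,
feeding `h x` to the copy of the right length and reading that copy's wires back — the
standard "hard-wire all cases" of uniform circuit families (Arora–Barak 2009, §6.1–6.2;
Nielsen–Chuang 2010, §3.1.2, §4.5). This file supplies the classical reversible gadgets of
that multiplexer, over an arbitrary wire type, with their semantics:

* `RevMux.swapOps ps` — three `CNOT`s per pair (Nielsen–Chuang §1.3.4): on pairwise distinct pairs the
  two wires of every pair exchange their values (`clEval_swapOps_snd/_fst/_of_forall_ne`); used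
  to bring the output bits to the front wires;
* `RevMux.flagOps emp flag L` — from *emptiness wires* `emp j` (cell `j` of a word register is empty)
  the **one-hot length flags** `flag ℓ`, `ℓ ≤ L`: `flag 0 ← emp 0`,
  `flag ℓ ← emp ℓ ∧ ¬ emp (ℓ-1)` (`NOT`, Toffoli, `NOT`; the emptiness wires are restored):
  `clEval_flagOps_flag`, `clEval_flagOps_of_forall_ne` (and `…_bdd` variants asking the
  disjointness `emp i ≠ flag j` only for `i, j ≤ L`), and `flagVal_profile`: on the profile
  of a word of length `ℓ*` (`emp j = [ℓ* ≤ j]`) exactly `flag ℓ*` is set;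
* `RevMux.muxOps flag src dst len L` — for `ℓ ≤ L` and `i < len ℓ` the Toffoli
  `dst ℓ i ← dst ℓ i ⊕ (flag ℓ ∧ src ℓ i)`: under one-hot flags at `ℓ*` only the chunk `ℓ*`
  fires (`clEval_muxOps_apply`); the two layouts used by the multiplexer are the **router**
  (targets distinct across chunks: `clEval_muxOps_route`) and the **selector** (all chunks
  target the same register `Y`: `clEval_muxOps_select`).

## References

* S. Arora, B. Barak, *Computational Complexity: A Modern Approach*, CUP 2009, §6.1–6.2
  (circuit families; a circuit for each input length), §10.3.7 Lemma 10.10 (reversible gates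
  on fresh wires).
* M. A. Nielsen, I. L. Chuang, *Quantum Computation and Quantum Information*, CUP 2010, §1.3.4
  (swap from three `CNOT`s), §3.2.5 (Toffoli, reversible classical control).
* E. Bernstein, U. Vazirani, *Quantum complexity theory*, SIAM J. Comput. 26 (1997), §8.
-/

namespace Literature.Computability.QuantumComplexity

open Function

variable {ι : Type*} [DecidableEq ι]

/-! ### A `flatMap` of chunks all but one of which are switched off -/

/-- `clToggle` of a `flatMap` all of whose chunks but the one at `a` have their guards off.
[folklore] -/
theorem clToggle_flatMap_of_guard {α : Type*} (l : List α) (f : α → List (ClOp ι))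
    (w : ι → Bool) (i : ι) (a : α) (hl : l.Nodup) (ha : a ∈ l)
    (h : ∀ a' ∈ l, a' ≠ a → ∀ op ∈ f a', op.guard w = false) :
    clToggle (l.flatMap f) w i = clToggle (f a) w i := by
  induction l with
  | nil => simp at ha
  | cons b l ih =>
    rw [List.nodup_cons] at hl
    rw [List.flatMap_cons, clToggle_append]
    rcases List.mem_cons.1 ha with rfl | ha
    · rw [clToggle_eq_false_of_guard (l.flatMap f) w i (fun op hop => ?_), Bool.xor_false]
      obtain ⟨a', ha', hop⟩ := List.mem_flatMap.1 hop
      exact h a' (List.mem_cons_of_mem _ ha') (fun e => hl.1 (e ▸ ha')) op hop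
    · rw [ih hl.2 ha (fun a' ha' hne => h a' (List.mem_cons_of_mem _ ha') hne),
        clToggle_eq_false_of_guard (f b) w i (fun op hop => ?_), Bool.false_xor]
      exact h b (by simp) (fun e => hl.1 (e ▸ ha)) op hop

/-- `clToggle` of a `flatMap` all of whose chunks have their guards off. [folklore] -/
theorem clToggle_flatMap_of_guard_off {α : Type*} (l : List α) (f : α → List (ClOp ι))
    (w : ι → Bool) (i : ι) (h : ∀ a' ∈ l, ∀ op ∈ f a', op.guard w = false) :
    clToggle (l.flatMap f) w i = false :=
  clToggle_eq_false_of_guard _ w i fun op hop => by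
    obtain ⟨a, ha, hop⟩ := List.mem_flatMap.1 hop
    exact h a ha op hop

namespace RevMux

/-! ### Swapping registers -/

/-- Three `CNOT`s per pair `(a, z)`: `CNOT a z; CNOT z a; CNOT a z`. [cite: NielsenChuang2010, §1.3.4 (swap from three CNOTs)] -/
def swapOps (ps : List (ι × ι)) : List (ClOp ι) :=
  ps.flatMap fun p => [ClOp.cnot p.1 p.2, ClOp.cnot p.2 p.1, ClOp.cnot p.1 p.2]

omit [DecidableEq ι] in
/-- `swapOps` of a list starting with the pair `p`. [folklore] -/
theorem swapOps_cons (p : ι × ι) (ps : List (ι × ι)) :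
    swapOps (p :: ps) = [ClOp.cnot p.1 p.2, ClOp.cnot p.2 p.1, ClOp.cnot p.1 p.2] ++ swapOps ps := rfl

omit [DecidableEq ι] in
/-- Membership in `swapOps`. [folklore] -/
theorem mem_swapOps {ps : List (ι × ι)} {op : ClOp ι} (hop : op ∈ swapOps ps) :
    ∃ p ∈ ps, op = ClOp.cnot p.1 p.2 ∨ op = ClOp.cnot p.2 p.1 := by
  simp only [swapOps, List.mem_flatMap, List.mem_cons, List.not_mem_nil, or_false] at hop
  obtain ⟨p, hp, h⟩ := hop
  refine ⟨p, hp, ?_⟩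
  rcases h with h | h | h
  · exact Or.inl h
  · exact Or.inr h
  · exact Or.inl h

/-- **One swap**: the values of `a` and `z` are exchanged, nothing else moves.
[cite: NielsenChuang2010, §1.3.4 (swap from three CNOTs)] -/
theorem clEval_swap (a z : ι) (haz : a ≠ z) (w : ι → Bool) :
    clEval [ClOp.cnot a z, ClOp.cnot z a, ClOp.cnot a z] w = fun i => if i = z then w a else if i = a then w z else w i := by
  set w1 : ι → Bool := update w z (w z ^^ w a) with hw1
  have hw1a : w1 a = w a := update_of_ne haz _ _
  have hw1z : w1 z = (w z ^^ w a) := update_self _ _ _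
  set w2 : ι → Bool := update w1 a (w1 a ^^ w1 z) with hw2
  have hw2z : w2 z = (w z ^^ w a) := by rw [hw2, update_of_ne (Ne.symm haz), hw1z]
  have hw2a : w2 a = w z := by
    rw [hw2, update_self, hw1a, hw1z]
    cases w a <;> cases w z <;> rfl
  have hstep : clEval [ClOp.cnot a z, ClOp.cnot z a, ClOp.cnot a z] w = update w2 z (w2 z ^^ w2 a) := by
    simp only [clEval_cons, clEval_nil, ClOp.eval_cnot, hw1, hw2]
  rw [hstep]
  funext i
  by_cases hiz : i = z
  · subst hiz
    rw [update_self, hw2z, hw2a, if_pos rfl]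
    cases w a <;> cases w i <;> rfl
  · rw [update_of_ne hiz, if_neg hiz]
    by_cases hia : i = a
    · subst hia
      rw [hw2a, if_pos rfl]
    · rw [if_neg hia, hw2, update_of_ne hia, hw1, update_of_ne hiz]

omit [DecidableEq ι] in
/-- The operations of `swapOps` on pairs of distinct wires are well formed. [folklore] -/
theorem swapOps_wf {ps : List (ι × ι)} (h : ∀ p ∈ ps, p.1 ≠ p.2) : ∀ op ∈ swapOps ps, op.WF := by
  intro op hop
  obtain ⟨p, hp, rfl | rfl⟩ := mem_swapOps hop
  · exact h p hp
  · exact (h p hp).symm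

/-- **Semantics of a swap layer on pairwise distinct pairs**: the second wire of each pair
receives the first, the first receives the second, all other wires are unchanged.
[cite: NielsenChuang2010, §1.3.4 (swap from three CNOTs)] -/
theorem clEval_swapOps (ps : List (ι × ι)) (h1 : (ps.map Prod.fst).Nodup) (h2 : (ps.map Prod.snd).Nodup)
    (h12 : ∀ p ∈ ps, ∀ q ∈ ps, p.1 ≠ q.2) (w : ι → Bool) :
    (∀ p ∈ ps, clEval (swapOps ps) w p.2 = w p.1) ∧ (∀ p ∈ ps, clEval (swapOps ps) w p.1 = w p.2) ∧
      (∀ i, (∀ p ∈ ps, i ≠ p.1 ∧ i ≠ p.2) → clEval (swapOps ps) w i = w i) := by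
  induction ps generalizing w with
  | nil => simp [swapOps]
  | cons p ps ih =>
    rw [List.map_cons, List.nodup_cons] at h1 h2
    have hp12 : p.1 ≠ p.2 := h12 p (by simp) p (by simp)
    have hrest : ∀ q ∈ ps, ∀ q' ∈ ps, q.1 ≠ q'.2 := fun q hq q' hq' =>
      h12 q (List.mem_cons_of_mem _ hq) q' (List.mem_cons_of_mem _ hq')
    have ih' := ih h1.2 h2.2 hrest
    -- the first pair, then the rest on the swapped assignment
    set w' : ι → Bool := fun i => if i = p.2 then w p.1 else if i = p.1 then w p.2 else w i with hw'
    obtain ⟨ih1, ih2, ih3⟩ := ih' w'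
    have hstep : clEval (swapOps (p :: ps)) w = clEval (swapOps ps) w' := by
      rw [swapOps_cons, clEval_append, clEval_swap p.1 p.2 hp12 w]
    -- wires of the rest avoid `p`
    have hq1 : ∀ q ∈ ps, q.1 ≠ p.1 ∧ q.1 ≠ p.2 := fun q hq =>
      ⟨fun e => h1.1 (e ▸ List.mem_map_of_mem hq), h12 q (List.mem_cons_of_mem _ hq) p (by simp)⟩
    have hq2 : ∀ q ∈ ps, q.2 ≠ p.1 ∧ q.2 ≠ p.2 := fun q hq =>
      ⟨fun e => h12 p (by simp) q (List.mem_cons_of_mem _ hq) e.symm, fun e => h2.1 (e ▸ List.mem_map_of_mem hq)⟩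
    refine ⟨fun q hq => ?_, fun q hq => ?_, fun i hi => ?_⟩
    · rw [hstep]
      rcases List.mem_cons.1 hq with rfl | hq
      · rw [ih3 q.2 (fun q' hq' => ⟨((hq1 q' hq').2).symm, ((hq2 q' hq').2).symm⟩)]
        simp [hw']
      · rw [ih1 q hq]
        simp [hw', (hq1 q hq).1, (hq1 q hq).2]
    · rw [hstep]
      rcases List.mem_cons.1 hq with rfl | hq
      · rw [ih3 q.1 (fun q' hq' => ⟨((hq1 q' hq').1).symm, ((hq2 q' hq').1).symm⟩)]
        simp [hw', hp12]
      · rw [ih2 q hq]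
        simp [hw', (hq2 q hq).1, (hq2 q hq).2]
    · rw [hstep, ih3 i (fun q hq => hi q (List.mem_cons_of_mem _ hq))]
      obtain ⟨hi1, hi2⟩ := hi p (by simp)
      simp [hw', hi1, hi2]

/-- A swap layer leaves the wires outside its pairs unchanged (no distinctness needed).
[folklore] -/
theorem clEval_swapOps_of_forall_ne (ps : List (ι × ι)) (w : ι → Bool) {i : ι}
    (hi : ∀ p ∈ ps, i ≠ p.1 ∧ i ≠ p.2) : clEval (swapOps ps) w i = w i :=
  clEval_apply_of_forall_target_ne _ _ fun op hop => by
    obtain ⟨p, hp, rfl | rfl⟩ := mem_swapOps hop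
    · exact (hi p hp).2.symm
    · exact (hi p hp).1.symm

/-! ### One-hot length flags from an emptiness profile -/

/-- The flag program: `flag 0 ← flag 0 ⊕ emp 0`, and for `ℓ < L` the chunk
`NOT (emp ℓ); flag (ℓ+1) ← flag (ℓ+1) ⊕ (emp (ℓ+1) ∧ emp ℓ); NOT (emp ℓ)` (i.e.
`⊕ (emp (ℓ+1) ∧ ¬ emp ℓ)`, the emptiness wire being restored). [cite: NielsenChuang2010, §3.2.5 (reversible classical control with Toffoli gates)] -/
def flagOps (emp flag : ℕ → ι) (L : ℕ) : List (ClOp ι) :=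
  ClOp.cnot (emp 0) (flag 0) :: (List.range L).flatMap fun ℓ =>
    [ClOp.not (emp ℓ), ClOp.toffoli (emp (ℓ + 1)) (emp ℓ) (flag (ℓ + 1)), ClOp.not (emp ℓ)]

/-- The intended value of flag `ℓ` on the assignment `w`: "cell `ℓ` is the first empty one".
[folklore] -/
def flagVal (emp : ℕ → ι) (w : ι → Bool) (ℓ : ℕ) : Bool :=
  if ℓ = 0 then w (emp 0) else (w (emp ℓ) && !w (emp (ℓ - 1)))

omit [DecidableEq ι] in
/-- `flagOps` with one more chunk. [folklore] -/
theorem flagOps_succ (emp flag : ℕ → ι) (L : ℕ) :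
    flagOps emp flag (L + 1) = flagOps emp flag L ++
      [ClOp.not (emp L), ClOp.toffoli (emp (L + 1)) (emp L) (flag (L + 1)), ClOp.not (emp L)] := by
  simp [flagOps, List.range_succ, List.flatMap_append]

/-- One chunk: only the new flag changes, by `emp (L+1) ∧ ¬ emp L`. [folklore] -/
theorem clEval_flagChunk (emp flag : ℕ → ι) (L : ℕ) (hef : ∀ i j, emp i ≠ flag j) (hemp : Injective emp)
    (u : ι → Bool) :
    clEval [ClOp.not (emp L), ClOp.toffoli (emp (L + 1)) (emp L) (flag (L + 1)), ClOp.not (emp L)] u =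
      update u (flag (L + 1)) (u (flag (L + 1)) ^^ (u (emp (L + 1)) && !u (emp L))) := by
  have h1 : flag (L + 1) ≠ emp L := (hef _ _).symm
  have h3 : emp (L + 1) ≠ emp L := fun e => absurd (hemp e) (Nat.succ_ne_self L)
  set u1 : ι → Bool := update u (emp L) (!u (emp L)) with hu1
  have hu1f : u1 (flag (L + 1)) = u (flag (L + 1)) := update_of_ne h1 _ _
  have hu1e' : u1 (emp (L + 1)) = u (emp (L + 1)) := update_of_ne h3 _ _
  have hu1e : u1 (emp L) = !u (emp L) := update_self _ _ _
  set u2 : ι → Bool := update u1 (flag (L + 1)) (u1 (flag (L + 1)) ^^ (u1 (emp (L + 1)) && u1 (emp L))) with hu2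
  have hu2e : u2 (emp L) = !u (emp L) := by rw [hu2, update_of_ne h1.symm, hu1e]
  have hstep : clEval [ClOp.not (emp L), ClOp.toffoli (emp (L + 1)) (emp L) (flag (L + 1)), ClOp.not (emp L)] u =
      update u2 (emp L) (!u2 (emp L)) := by
    simp only [clEval_cons, clEval_nil, ClOp.eval_not, ClOp.eval_toffoli, hu1, hu2]
  rw [hstep]
  funext i
  by_cases hi : i = emp L
  · subst hi
    rw [update_self, hu2e, update_of_ne h1.symm, Bool.not_not]
  · rw [update_of_ne hi]
    by_cases hif : i = flag (L + 1)
    · subst hif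
      rw [hu2, update_self, update_self, hu1f, hu1e', hu1e]
    · rw [hu2, update_of_ne hif, update_of_ne hif, hu1, update_of_ne hi]

/-- **Semantics of the flag program** (flags initially `0`, emptiness and flag wires
disjoint, flags distinct): flag `ℓ ≤ L` receives `flagVal ℓ`, every other wire — in
particular every emptiness wire — keeps its value. [cite: NielsenChuang2010, §3.2.5 (reversible classical control with Toffoli gates)] -/
theorem clEval_flagOps (emp flag : ℕ → ι) (hef : ∀ i j, emp i ≠ flag j) (hemp : Injective emp)
    (hflag : Injective flag) (w : ι → Bool) :
    ∀ L : ℕ, (∀ ℓ ≤ L, w (flag ℓ) = false) →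
      (∀ ℓ ≤ L, clEval (flagOps emp flag L) w (flag ℓ) = flagVal emp w ℓ) ∧
      (∀ i, (∀ ℓ ≤ L, i ≠ flag ℓ) → clEval (flagOps emp flag L) w i = w i)
  | 0, hw => by
    have h0 : clEval (flagOps emp flag 0) w = update w (flag 0) (w (emp 0)) := by
      simp only [flagOps, List.range_zero, List.flatMap_nil, clEval_cons, clEval_nil, ClOp.eval_cnot]
      rw [hw 0 le_rfl, Bool.false_xor]
    refine ⟨fun ℓ hℓ => ?_, fun i hi => ?_⟩
    · obtain rfl : ℓ = 0 := Nat.le_zero.1 hℓ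
      rw [h0, update_self, flagVal, if_pos rfl]
    · rw [h0, update_of_ne (hi 0 le_rfl)]
  | L + 1, hw => by
    obtain ⟨ihf, iho⟩ := clEval_flagOps emp flag hef hemp hflag w L (fun ℓ hℓ => hw ℓ (Nat.le_succ_of_le hℓ))
    set u := clEval (flagOps emp flag L) w with hu
    have hstep : clEval (flagOps emp flag (L + 1)) w =
        update u (flag (L + 1)) (u (flag (L + 1)) ^^ (u (emp (L + 1)) && !u (emp L))) := by
      rw [flagOps_succ, clEval_append, ← hu, clEval_flagChunk emp flag L hef hemp u]
    have huf : u (flag (L + 1)) = false := by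
      rw [iho (flag (L + 1)) (fun ℓ hℓ e => absurd (hflag e) (by omega)), hw (L + 1) le_rfl]
    have hue : ∀ j, u (emp j) = w (emp j) := fun j => iho (emp j) (fun ℓ _ => hef j ℓ)
    refine ⟨fun ℓ hℓ => ?_, fun i hi => ?_⟩
    · rw [hstep]
      rcases Nat.lt_or_ge ℓ (L + 1) with hlt | hge
      · rw [update_of_ne (fun e => absurd (hflag e) (by omega))]
        exact ihf ℓ (Nat.lt_succ_iff.1 hlt)
      · obtain rfl : ℓ = L + 1 := le_antisymm hℓ hge
        rw [update_self, huf, Bool.false_xor, hue, hue, flagVal, if_neg (Nat.succ_ne_zero L), Nat.add_sub_cancel]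
    · rw [hstep, update_of_ne (hi (L + 1) le_rfl)]
      exact iho i (fun ℓ hℓ => hi ℓ (Nat.le_succ_of_le hℓ))

/-- The flags after the program. [folklore] -/
theorem clEval_flagOps_flag (emp flag : ℕ → ι) (hef : ∀ i j, emp i ≠ flag j) (hemp : Injective emp)
    (hflag : Injective flag) (w : ι → Bool) {L ℓ : ℕ} (hw : ∀ ℓ ≤ L, w (flag ℓ) = false) (hℓ : ℓ ≤ L) :
    clEval (flagOps emp flag L) w (flag ℓ) = flagVal emp w ℓ :=
  (clEval_flagOps emp flag hef hemp hflag w L hw).1 ℓ hℓ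

/-- The other wires after the program. [folklore] -/
theorem clEval_flagOps_of_forall_ne (emp flag : ℕ → ι) (hef : ∀ i j, emp i ≠ flag j) (hemp : Injective emp)
    (hflag : Injective flag) (w : ι → Bool) {L : ℕ} (hw : ∀ ℓ ≤ L, w (flag ℓ) = false) {i : ι}
    (hi : ∀ ℓ ≤ L, i ≠ flag ℓ) : clEval (flagOps emp flag L) w i = w i :=
  (clEval_flagOps emp flag hef hemp hflag w L hw).2 i hi

omit [DecidableEq ι] in
/-- **On the emptiness profile of a word of length `ℓ*`** (cells below `ℓ*` full, from `ℓ*`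
on empty) the flags are one-hot at `ℓ*`. [folklore] -/
theorem flagVal_profile (emp : ℕ → ι) (w : ι → Bool) (ls : ℕ) {L : ℕ}
    (hprof : ∀ j ≤ L, w (emp j) = decide (ls ≤ j)) {ℓ : ℕ} (hℓ : ℓ ≤ L) :
    flagVal emp w ℓ = decide (ℓ = ls) := by
  unfold flagVal
  split_ifs with h0
  · subst h0
    rw [hprof 0 hℓ]
    by_cases h : ls = 0
    · subst h; simp
    · have h' : ¬ (0 = ls) := fun e => h e.symm
      simp [h, h']
  · rw [hprof ℓ hℓ, hprof (ℓ - 1) (by omega)]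
    by_cases h : ℓ = ls
    · subst h
      have h2 : ¬ (ℓ ≤ ℓ - 1) := by omega
      simp [h2]
    · by_cases h1 : ls ≤ ℓ
      · have : ls ≤ ℓ - 1 := by omega
        simp [h, h1, this]
      · simp [h, h1]

omit [DecidableEq ι] in
/-- The operations of the flag program are well formed when the emptiness wires are distinct
and disjoint from the flags. [folklore] -/
theorem flagOps_wf (emp flag : ℕ → ι) (hef : ∀ i j, emp i ≠ flag j) (hemp : Injective emp) (L : ℕ) :
    ∀ op ∈ flagOps emp flag L, op.WF := by
  intro op hop
  simp only [flagOps, List.mem_cons, List.mem_flatMap, List.mem_range] at hop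
  rcases hop with rfl | ⟨ℓ, -, hℓ⟩
  · exact hef 0 0
  · cases op with
    | not i => trivial
    | cnot i j => simp at hℓ
    | toffoli a b c =>
      simp only [ClOp.toffoli.injEq, List.not_mem_nil, reduceCtorEq, false_or, or_false] at hℓ
      obtain ⟨rfl, rfl, rfl⟩ := hℓ
      exact ⟨fun e => absurd (hemp e) (Nat.succ_ne_self ℓ), hef _ _, hef _ _⟩

/-! #### Bounded hypotheses

In a concrete layout the emptiness wires `emp j` are meaningful (and disjoint from the flags)
only for `j ≤ L`; the following variants ask for disjointness on that range only. -/

/-- One chunk, with exactly the two distinctness facts it needs. [folklore] -/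
theorem clEval_flagChunk' (emp flag : ℕ → ι) (L : ℕ) (h1 : flag (L + 1) ≠ emp L) (h3 : emp (L + 1) ≠ emp L)
    (u : ι → Bool) :
    clEval [ClOp.not (emp L), ClOp.toffoli (emp (L + 1)) (emp L) (flag (L + 1)), ClOp.not (emp L)] u =
      update u (flag (L + 1)) (u (flag (L + 1)) ^^ (u (emp (L + 1)) && !u (emp L))) := by
  set u1 : ι → Bool := update u (emp L) (!u (emp L)) with hu1
  have hu1f : u1 (flag (L + 1)) = u (flag (L + 1)) := update_of_ne h1 _ _
  have hu1e' : u1 (emp (L + 1)) = u (emp (L + 1)) := update_of_ne h3 _ _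
  have hu1e : u1 (emp L) = !u (emp L) := update_self _ _ _
  set u2 : ι → Bool := update u1 (flag (L + 1)) (u1 (flag (L + 1)) ^^ (u1 (emp (L + 1)) && u1 (emp L))) with hu2
  have hu2e : u2 (emp L) = !u (emp L) := by rw [hu2, update_of_ne h1.symm, hu1e]
  have hstep : clEval [ClOp.not (emp L), ClOp.toffoli (emp (L + 1)) (emp L) (flag (L + 1)), ClOp.not (emp L)] u =
      update u2 (emp L) (!u2 (emp L)) := by
    simp only [clEval_cons, clEval_nil, ClOp.eval_not, ClOp.eval_toffoli, hu1, hu2]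
  rw [hstep]
  funext i
  by_cases hi : i = emp L
  · subst hi
    rw [update_self, hu2e, update_of_ne h1.symm, Bool.not_not]
  · rw [update_of_ne hi]
    by_cases hif : i = flag (L + 1)
    · subst hif
      rw [hu2, update_self, update_self, hu1f, hu1e', hu1e]
    · rw [hu2, update_of_ne hif, update_of_ne hif, hu1, update_of_ne hi]

/-- **Semantics of the flag program, bounded hypotheses**: emptiness wires distinct
(`Injective emp`), flags distinct, and `emp i ≠ flag j` for `i, j ≤ L` only.
[cite: NielsenChuang2010, §3.2.5 (reversible classical control with Toffoli gates)] -/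
theorem clEval_flagOps_bdd (emp flag : ℕ → ι) (hemp : Injective emp) (hflag : Injective flag) (w : ι → Bool) :
    ∀ L : ℕ, (∀ i ≤ L, ∀ j ≤ L, emp i ≠ flag j) → (∀ ℓ ≤ L, w (flag ℓ) = false) →
      (∀ ℓ ≤ L, clEval (flagOps emp flag L) w (flag ℓ) = flagVal emp w ℓ) ∧
      (∀ i, (∀ ℓ ≤ L, i ≠ flag ℓ) → clEval (flagOps emp flag L) w i = w i)
  | 0, hef, hw => by
    have h0 : clEval (flagOps emp flag 0) w = update w (flag 0) (w (emp 0)) := by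
      simp only [flagOps, List.range_zero, List.flatMap_nil, clEval_cons, clEval_nil, ClOp.eval_cnot]
      rw [hw 0 le_rfl, Bool.false_xor]
    refine ⟨fun ℓ hℓ => ?_, fun i hi => ?_⟩
    · obtain rfl : ℓ = 0 := Nat.le_zero.1 hℓ
      rw [h0, update_self, flagVal, if_pos rfl]
    · rw [h0, update_of_ne (hi 0 le_rfl)]
  | L + 1, hef, hw => by
    obtain ⟨ihf, iho⟩ := clEval_flagOps_bdd emp flag hemp hflag w L
      (fun i hi j hj => hef i (Nat.le_succ_of_le hi) j (Nat.le_succ_of_le hj)) (fun ℓ hℓ => hw ℓ (Nat.le_succ_of_le hℓ))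
    set u := clEval (flagOps emp flag L) w with hu
    have h1 : flag (L + 1) ≠ emp L := (hef L (Nat.le_succ L) (L + 1) le_rfl).symm
    have h3 : emp (L + 1) ≠ emp L := fun e => absurd (hemp e) (Nat.succ_ne_self L)
    have hstep : clEval (flagOps emp flag (L + 1)) w =
        update u (flag (L + 1)) (u (flag (L + 1)) ^^ (u (emp (L + 1)) && !u (emp L))) := by
      rw [flagOps_succ, clEval_append, ← hu, clEval_flagChunk' emp flag L h1 h3 u]
    have huf : u (flag (L + 1)) = false := by
      rw [iho (flag (L + 1)) (fun ℓ hℓ e => absurd (hflag e) (by omega)), hw (L + 1) le_rfl]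
    have hueL : u (emp L) = w (emp L) := iho (emp L) (fun ℓ hℓ => hef L (Nat.le_succ L) ℓ (Nat.le_succ_of_le hℓ))
    have hueL1 : u (emp (L + 1)) = w (emp (L + 1)) :=
      iho (emp (L + 1)) (fun ℓ hℓ => hef (L + 1) le_rfl ℓ (Nat.le_succ_of_le hℓ))
    refine ⟨fun ℓ hℓ => ?_, fun i hi => ?_⟩
    · rw [hstep]
      rcases Nat.lt_or_ge ℓ (L + 1) with hlt | hge
      · rw [update_of_ne (fun e => absurd (hflag e) (by omega))]
        exact ihf ℓ (Nat.lt_succ_iff.1 hlt)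
      · obtain rfl : ℓ = L + 1 := le_antisymm hℓ hge
        rw [update_self, huf, Bool.false_xor, hueL, hueL1, flagVal, if_neg (Nat.succ_ne_zero L), Nat.add_sub_cancel]
    · rw [hstep, update_of_ne (hi (L + 1) le_rfl)]
      exact iho i (fun ℓ hℓ => hi ℓ (Nat.le_succ_of_le hℓ))

/-- The flags after the program (bounded hypotheses). [folklore] -/
theorem clEval_flagOps_flag_bdd (emp flag : ℕ → ι) (hemp : Injective emp) (hflag : Injective flag) (w : ι → Bool)
    {L ℓ : ℕ} (hef : ∀ i ≤ L, ∀ j ≤ L, emp i ≠ flag j) (hw : ∀ ℓ ≤ L, w (flag ℓ) = false) (hℓ : ℓ ≤ L) :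
    clEval (flagOps emp flag L) w (flag ℓ) = flagVal emp w ℓ :=
  (clEval_flagOps_bdd emp flag hemp hflag w L hef hw).1 ℓ hℓ

/-- The other wires after the program (bounded hypotheses). [folklore] -/
theorem clEval_flagOps_of_forall_ne_bdd (emp flag : ℕ → ι) (hemp : Injective emp) (hflag : Injective flag)
    (w : ι → Bool) {L : ℕ} (hef : ∀ i ≤ L, ∀ j ≤ L, emp i ≠ flag j) (hw : ∀ ℓ ≤ L, w (flag ℓ) = false)
    {i : ι} (hi : ∀ ℓ ≤ L, i ≠ flag ℓ) : clEval (flagOps emp flag L) w i = w i :=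
  (clEval_flagOps_bdd emp flag hemp hflag w L hef hw).2 i hi

omit [DecidableEq ι] in
/-- The flag program is well formed under the bounded hypotheses. [folklore] -/
theorem flagOps_wf_bdd (emp flag : ℕ → ι) {L : ℕ} (hef : ∀ i ≤ L, ∀ j ≤ L, emp i ≠ flag j) (hemp : Injective emp) :
    ∀ op ∈ flagOps emp flag L, op.WF := by
  intro op hop
  simp only [flagOps, List.mem_cons, List.mem_flatMap, List.mem_range] at hop
  rcases hop with rfl | ⟨ℓ, hℓL, hℓ⟩
  · exact hef 0 (Nat.zero_le _) 0 (Nat.zero_le _)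
  · cases op with
    | not i => trivial
    | cnot i j => simp at hℓ
    | toffoli a b c =>
      simp only [ClOp.toffoli.injEq, List.not_mem_nil, reduceCtorEq, false_or, or_false] at hℓ
      obtain ⟨rfl, rfl, rfl⟩ := hℓ
      exact ⟨fun e => absurd (hemp e) (Nat.succ_ne_self ℓ), hef (ℓ + 1) hℓL (ℓ + 1) hℓL,
        hef ℓ (Nat.le_of_lt hℓL) (ℓ + 1) hℓL⟩

/-! ### Flag-controlled copies: the multiplexer chunks -/

/-- The chunk of length `ℓ`: for `i < len`, `dst i ← dst i ⊕ (flag ∧ src i)`. [folklore] -/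
def muxChunk (fl : ι) (src dst : ℕ → ι) (len : ℕ) : List (ClOp ι) :=
  (List.range len).map fun i => ClOp.toffoli fl (src i) (dst i)

/-- **The multiplexer**: the chunks of all lengths `ℓ ≤ L`. [cite: AroraBarak2009, §6.2 (a circuit for each input length, hard-wired)] -/
def muxOps (flag : ℕ → ι) (src dst : ℕ → ℕ → ι) (len : ℕ → ℕ) (L : ℕ) : List (ClOp ι) :=
  (List.range (L + 1)).flatMap fun ℓ => muxChunk (flag ℓ) (src ℓ) (dst ℓ) (len ℓ)

omit [DecidableEq ι] in
/-- Membership in a chunk. [folklore] -/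
theorem mem_muxChunk {fl : ι} {src dst : ℕ → ι} {len : ℕ} {op : ClOp ι} :
    op ∈ muxChunk fl src dst len ↔ ∃ i < len, op = ClOp.toffoli fl (src i) (dst i) := by
  simp only [muxChunk, List.mem_map, List.mem_range]
  constructor
  · rintro ⟨i, hi, rfl⟩; exact ⟨i, hi, rfl⟩
  · rintro ⟨i, hi, rfl⟩; exact ⟨i, hi, rfl⟩

omit [DecidableEq ι] in
/-- Membership in the multiplexer. [folklore] -/
theorem mem_muxOps {flag : ℕ → ι} {src dst : ℕ → ℕ → ι} {len : ℕ → ℕ} {L : ℕ} {op : ClOp ι} :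
    op ∈ muxOps flag src dst len L ↔ ∃ ℓ ≤ L, ∃ i < len ℓ, op = ClOp.toffoli (flag ℓ) (src ℓ i) (dst ℓ i) := by
  simp only [muxOps, List.mem_flatMap, List.mem_range, Nat.lt_succ_iff, mem_muxChunk]

omit [DecidableEq ι] in
/-- The operations of the multiplexer are well formed when targets avoid flags and sources and
flags avoid sources. [folklore] -/
theorem muxOps_wf {flag : ℕ → ι} {src dst : ℕ → ℕ → ι} {len : ℕ → ℕ} {L : ℕ}
    (hdf : ∀ ℓ ≤ L, ∀ i < len ℓ, ∀ ℓ' ≤ L, dst ℓ i ≠ flag ℓ')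
    (hds : ∀ ℓ ≤ L, ∀ i < len ℓ, ∀ ℓ' ≤ L, ∀ i' < len ℓ', dst ℓ i ≠ src ℓ' i')
    (hfs : ∀ ℓ ≤ L, ∀ i < len ℓ, flag ℓ ≠ src ℓ i) :
    ∀ op ∈ muxOps flag src dst len L, op.WF := by
  intro op hop
  obtain ⟨ℓ, hℓ, i, hi, rfl⟩ := mem_muxOps.1 hop
  exact ⟨hfs ℓ hℓ i hi, (hdf ℓ hℓ i hi ℓ hℓ).symm, (hds ℓ hℓ i hi ℓ hℓ i hi).symm⟩

/-- The toggle of a chunk whose flag is on, at one of its (distinct) targets: the source bit.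
[folklore] -/
theorem clToggle_muxChunk_dst {fl : ι} {src dst : ℕ → ι} {len : ℕ} (w : ι → Bool) (hfl : w fl = true)
    (hinj : ∀ i < len, ∀ i' < len, dst i = dst i' → i = i') {i : ℕ} (hi : i < len) :
    clToggle (muxChunk fl src dst len) w (dst i) = w (src i) := by
  have hnd : ((muxChunk fl src dst len).map ClOp.target).Nodup := by
    rw [muxChunk, List.map_map]
    refine (List.nodup_range.map_on ?_)
    intro a ha b hb h
    exact hinj a (List.mem_range.1 ha) b (List.mem_range.1 hb) h
  have := clToggle_eq_guard_of_nodup (muxChunk fl src dst len) w hnd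
    (op := ClOp.toffoli fl (src i) (dst i)) (mem_muxChunk.2 ⟨i, hi, rfl⟩)
  simpa [ClOp.target, ClOp.guard, hfl] using this

/-- The toggle of a chunk outside its targets vanishes. [folklore] -/
theorem clToggle_muxChunk_of_forall_ne {fl : ι} {src dst : ℕ → ι} {len : ℕ} (w : ι → Bool) {j : ι}
    (hj : ∀ i < len, dst i ≠ j) : clToggle (muxChunk fl src dst len) w j = false :=
  clToggle_eq_false_of_forall_ne _ w fun op hop => by
    obtain ⟨i, hi, rfl⟩ := mem_muxChunk.1 hop
    exact hj i hi

/-- **Under one-hot flags only the live chunk acts**: with `flag ℓ = [ℓ = ℓ*]` for `ℓ ≤ L` and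
targets that are never controls, every wire is toggled by the live chunk alone (by nothing if
`ℓ* > L`). [cite: NielsenChuang2010, §3.2.5 (reversible classical control with Toffoli gates)] -/
theorem clEval_muxOps_apply {flag : ℕ → ι} {src dst : ℕ → ℕ → ι} {len : ℕ → ℕ} {L : ℕ} (w : ι → Bool) (ls : ℕ)
    (hflag : ∀ ℓ ≤ L, w (flag ℓ) = decide (ℓ = ls))
    (hdf : ∀ ℓ ≤ L, ∀ i < len ℓ, ∀ ℓ' ≤ L, dst ℓ i ≠ flag ℓ')
    (hds : ∀ ℓ ≤ L, ∀ i < len ℓ, ∀ ℓ' ≤ L, ∀ i' < len ℓ', dst ℓ i ≠ src ℓ' i') (j : ι) :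
    clEval (muxOps flag src dst len L) w j =
      (w j ^^ (if ls ≤ L then clToggle (muxChunk (flag ls) (src ls) (dst ls) (len ls)) w j else false)) := by
  have hdisj : ∀ op ∈ muxOps flag src dst len L, ∀ op' ∈ muxOps flag src dst len L, op'.target ∉ op.controls := by
    intro op hop op' hop'
    obtain ⟨ℓ, hℓ, i, hi, rfl⟩ := mem_muxOps.1 hop
    obtain ⟨ℓ', hℓ', i', hi', rfl⟩ := mem_muxOps.1 hop'
    simp only [ClOp.target, ClOp.controls, List.mem_cons, List.not_mem_nil, or_false, not_or]
    exact ⟨hdf ℓ' hℓ' i' hi' ℓ hℓ, hds ℓ' hℓ' i' hi' ℓ hℓ i hi⟩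
  rw [clEval_apply_of_disjoint _ hdisj]
  congr 1
  have hoff : ∀ ℓ ∈ List.range (L + 1), ℓ ≠ ls → ∀ op ∈ muxChunk (flag ℓ) (src ℓ) (dst ℓ) (len ℓ), op.guard w = false := by
    intro ℓ hℓ hne op hop
    obtain ⟨i, -, rfl⟩ := mem_muxChunk.1 hop
    have hℓ' : ℓ ≤ L := Nat.lt_succ_iff.1 (List.mem_range.1 hℓ)
    simp [ClOp.guard, hflag ℓ hℓ', hne]
  split_ifs with hls
  · exact clToggle_flatMap_of_guard _ _ w j ls List.nodup_range (List.mem_range.2 (Nat.lt_succ_of_le hls)) hoff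
  · exact clToggle_flatMap_of_guard_off _ _ w j fun ℓ hℓ op hop =>
      hoff ℓ hℓ (fun e => hls (e ▸ Nat.lt_succ_iff.1 (List.mem_range.1 hℓ))) op hop

/-- The multiplexer leaves the wires outside its targets unchanged (no hypothesis on the
flags). [folklore] -/
theorem clEval_muxOps_of_forall_ne {flag : ℕ → ι} {src dst : ℕ → ℕ → ι} {len : ℕ → ℕ} {L : ℕ} (w : ι → Bool)
    {j : ι} (hj : ∀ ℓ ≤ L, ∀ i < len ℓ, dst ℓ i ≠ j) : clEval (muxOps flag src dst len L) w j = w j :=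
  clEval_apply_of_forall_target_ne _ _ fun op hop => by
    obtain ⟨ℓ, hℓ, i, hi, rfl⟩ := mem_muxOps.1 hop
    exact hj ℓ hℓ i hi

/-- **The router** (targets distinct across all chunks, e.g. the input registers of the
copies of all lengths): under one-hot flags at `ℓ*`, the target `dst ℓ i` receives `src ℓ i`
if `ℓ = ℓ*` and is unchanged otherwise. [cite: AroraBarak2009, §6.2 (a circuit for each input length, hard-wired)] -/
theorem clEval_muxOps_route {flag : ℕ → ι} {src dst : ℕ → ℕ → ι} {len : ℕ → ℕ} {L : ℕ} (w : ι → Bool) (ls : ℕ)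
    (hflag : ∀ ℓ ≤ L, w (flag ℓ) = decide (ℓ = ls))
    (hdf : ∀ ℓ ≤ L, ∀ i < len ℓ, ∀ ℓ' ≤ L, dst ℓ i ≠ flag ℓ')
    (hds : ∀ ℓ ≤ L, ∀ i < len ℓ, ∀ ℓ' ≤ L, ∀ i' < len ℓ', dst ℓ i ≠ src ℓ' i')
    (hinj : ∀ ℓ ≤ L, ∀ i < len ℓ, ∀ ℓ' ≤ L, ∀ i' < len ℓ', dst ℓ i = dst ℓ' i' → ℓ = ℓ' ∧ i = i')
    {ℓ i : ℕ} (hℓ : ℓ ≤ L) (hi : i < len ℓ) :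
    clEval (muxOps flag src dst len L) w (dst ℓ i) = (w (dst ℓ i) ^^ (decide (ℓ = ls) && w (src ℓ i))) := by
  rw [clEval_muxOps_apply w ls hflag hdf hds]
  congr 1
  by_cases hls : ls ≤ L
  · rw [if_pos hls]
    by_cases he : ℓ = ls
    · subst he
      rw [clToggle_muxChunk_dst w (by rw [hflag ℓ hℓ]; simp) (fun a ha b hb h => (hinj ℓ hℓ a ha ℓ hℓ b hb h).2) hi]
      simp
    · rw [clToggle_muxChunk_of_forall_ne w (fun i' hi' h => he (hinj ls hls i' hi' ℓ hℓ i hi h).1.symm)]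
      simp [he]
  · rw [if_neg hls]
    have he : ℓ ≠ ls := fun e => hls (e ▸ hℓ)
    simp [he]

/-- **The selector** (all chunks target the same register `Y`, e.g. reading back the wires of
the copy of the right length): under one-hot flags at `ℓ* ≤ L`, `Y i` receives `src ℓ* i` for
`i < len ℓ*` and is unchanged beyond. [cite: AroraBarak2009, §6.2 (a circuit for each input length, hard-wired)] -/
theorem clEval_muxOps_select {flag : ℕ → ι} {src : ℕ → ℕ → ι} {Y : ℕ → ι} {len : ℕ → ℕ} {L : ℕ} (w : ι → Bool) (ls : ℕ)
    (hflag : ∀ ℓ ≤ L, w (flag ℓ) = decide (ℓ = ls))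
    (hdf : ∀ ℓ ≤ L, ∀ i < len ℓ, ∀ ℓ' ≤ L, Y i ≠ flag ℓ')
    (hds : ∀ ℓ ≤ L, ∀ i < len ℓ, ∀ ℓ' ≤ L, ∀ i' < len ℓ', Y i ≠ src ℓ' i')
    (hY : Injective Y) (hls : ls ≤ L) (i : ℕ) :
    clEval (muxOps flag src (fun _ => Y) len L) w (Y i) = (w (Y i) ^^ (decide (i < len ls) && w (src ls i))) := by
  rw [clEval_muxOps_apply (dst := fun _ => Y) w ls hflag hdf hds, if_pos hls]
  congr 1
  by_cases hi : i < len ls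
  · rw [clToggle_muxChunk_dst (dst := Y) w (by rw [hflag ls hls]; simp) (fun a _ b _ h => hY h) hi]
    simp [hi]
  · rw [clToggle_muxChunk_of_forall_ne (dst := Y) w (fun i' hi' h => hi ?_)]
    · simp [hi]
    · rwa [hY h] at hi' 

end RevMux

end Literature.Computability.QuantumComplexity
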